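import Literature.AnabelianGeometry.SemiGraphs.PSCSeparatingCoveringsProofs2
import Literature.GroupTheory.CompactGroupIntersections
import Mathlib.Topology.Algebra.ClopenNhdofOne
import HarnessLib

/-!
# [CombGC] Thm. 1.6 (i)(ii): verticial / cuspidal / nodal subgroups of `Π_G` are recognised LEVEL-WISE
# ("recovered as the stabilizers of vertices / cusps of finite étale coverings"), and so is the
# group-theoretic verticiality / cuspidality / edge-likeness of `α : Π_G ≅ Π_H`

Mochizuki, *A combinatorial version of the Grothendieck conjecture*, Tohoku Math. J. **59** (2007) [CombGC],
proof of Theorem 1.6, author's ms p. 13 l.−9 – −7 ("Since the cuspidal edge-like subgroups may be recovered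
as the stabilizers of cusps of finite étale coverings of `G`, `H`, it suffices to show that `α` induces a
functorial bijection between the sets of cusps of `G`, `H`") and p. 14 l.25–28 ("Now to prove that `α` is
group-theoretically verticial, it suffices to prove [cf. the proof of assertion (i)] that `α` induces a
functorial bijection between the sets of vertices of `G`, `H`"), read on the render
`paper:url-6994f81053dc` p0013–p0014.  [cite: MochizukiCombGC2007, Thm 1.6(ii) p.14]

PROOF-ONLY file (abc-iut cell, layer L3, `plan/L3/SUBDAG-CombGC-Thm16.md`, support row under T16-L09b /
T16-L06 "descend the conclusion to `α`": the `Π_G`-LEVEL twin of rows T16-L14 (`PSCVertexStabilizerProofs`,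
abc-iut-w4-d052) and of `PSCUnrVerticialLevelwiseProofs` (abc-iut-L5-t6), which treat `Π^unr_G`).  Over
abc-iut-L3-t4's interface `PSCDatum Π` (`PSCFundamentalGroup.lean`, `PSCGraphicity.lean`), for PROFINITE
`Π` (compact, totally disconnected topological group) and a FINITE family `S : ι → Subgroup Π` of CLOSED
subgroups — the verticial `Π_v`, nodal `Π_e`, cuspidal `Π_c`, or edge-like `Π_e`/`Π_c` families of a datum:

* `eq_iInf_sup_of_isClosed` — a closed subgroup `A` is the intersection `⋂_U (U ⊔ A)` over the open normal
  `U` (its stabilizer description: `U ⊔ Π_v^γ = U · Π_v^γ` is the stabilizer in `Π_G` of the vertex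
  `U γ Π_v` of the covering `G_U`);
* `conjClass_iff_levelwise` — `B` is a `Π`-conjugate of some `S i` if and only if `B` is closed and AT
  EVERY LEVEL `U` (open normal) `B ⊔ U = U ⊔ γ • S i` for SOME `i`, `γ` — no compatibility between the
  levels assumed (a coherent choice is extracted by a compactness selection, as in the `Π^unr` file);
  specialisations `isVerticial_iff_levelwise`, `isCuspidal_iff_levelwise`, `isNodal_iff_levelwise`,
  `isEdgeLike_iff_levelwise`;
* `transport_iff_levelwise` — for a topological isomorphism `α : Π ≅ Π'` and finite closed families `S`,
  `T`: "`α` carries the `Π`-conjugates of the `S i` onto the `Π'`-conjugates of the `T j` and every such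
  conjugate arises" if and only if at every level `U` and for every `V ≥ U`:
  `(∃ i γ, V = U ⊔ γ • S i) ↔ (∃ j δ, α V = α U ⊔ δ • T j)` — i.e. iff `α` induces, functorially in the
  level, `Π/U`-equivariant bijections between the finite sets of `S`-objects and `T`-objects of the
  corresponding coverings, read on their stabilizers; specialisations
  **`isGroupTheoreticallyVerticial_iff_levelwise`**, **`isGroupTheoreticallyCuspidal_iff_levelwise`**,
  **`isGroupTheoreticallyEdgeLike_iff_levelwise`** (Def. 1.4 (iv)).
These are the formal content of the two quoted sentences; they are what makes the DESCENT steps of the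
proof of Thm. 1.6 (ii) (from finite étale coverings, row T16-L06; from the compactifications, row
T16-L09b) statements about the vertex / cusp SETS of the coverings level by level.  Plain profinite group
theory over the interface; no statement of [CombGC] is asserted; nothing here takes a side on [IUTchIII]
Cor. 3.12.
-/

noncomputable section

namespace Literature.AnabelianGeometry.SemiGraphs

namespace PSCDatum

open scoped Pointwise

universe u

variable {P : Type u} [Group P] [TopologicalSpace P]

/-! ### 1. Lattice identities for the level-wise stabilizers `B ⊔ U` -/

omit [TopologicalSpace P] in
/-- Conjugating by an element of the normal subgroup `U` does not change `U ⊔ X`: the stabilizer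
`U ⊔ Π_v^γ` of the vertex `U γ Π_v` of `G_U` depends only on the coset `U γ`.
[cite: MochizukiCombGC2007, Def 1.1(ii) p.6] -/
theorem sup_conjAct_smul_eq_of_mem' {U : Subgroup P} (hU : U.Normal) {u : P} (hu : u ∈ U)
    (X : Subgroup P) : U ⊔ ConjAct.toConjAct u • X = U ⊔ X := by
  have h1 : ConjAct.toConjAct u • (U ⊔ X) = U ⊔ X :=
    Subgroup.conjAct_pointwise_smul_eq_self (Subgroup.le_normalizer (Subgroup.mem_sup_left hu))
  rwa [Subgroup.smul_sup, hU.conjAct (ConjAct.toConjAct u)] at h1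

omit [TopologicalSpace P] in
/-- If `B ⊔ U' = U' ⊔ X` at a level `U'`, then `B ⊔ U = U ⊔ X` at every coarser level `U ⊇ U'`.
[cite: MochizukiCombGC2007, Def 1.1(ii) p.6] -/
theorem sup_eq_sup_of_le' {B U U' X : Subgroup P} (hUU' : U' ≤ U) (h : B ⊔ U' = U' ⊔ X) :
    B ⊔ U = U ⊔ X := by
  calc B ⊔ U = B ⊔ U' ⊔ U := by rw [sup_assoc, sup_eq_right.mpr hUU']
    _ = U' ⊔ X ⊔ U := by rw [h]
    _ = U ⊔ X := by rw [sup_right_comm, sup_eq_right.mpr hUU']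

/-- A subset of a topological group which is saturated for left multiplication by an open subgroup
`U` (a union of cosets `U g`) is clopen. [cite: MochizukiCombGC2007, Def 1.1(ii) p.6] -/
theorem isClopen_of_forall_mul_mem_iff' [IsTopologicalGroup P] {U : Subgroup P}
    (hU : IsOpen (U : Set P)) {C : Set P} (h : ∀ u ∈ U, ∀ g : P, u * g ∈ C ↔ g ∈ C) : IsClopen C := by
  have hopen : ∀ D : Set P, (∀ u ∈ U, ∀ g : P, u * g ∈ D ↔ g ∈ D) → IsOpen D := by
    intro D hD
    refine isOpen_iff_forall_mem_open.mpr fun g hg => ?_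
    refine ⟨(fun u : P => u * g) '' (U : Set P), ?_, (isOpenMap_mul_right g) _ hU,
      ⟨1, U.one_mem, one_mul g⟩⟩
    rintro _ ⟨u, hu, rfl⟩
    exact (hD u hu g).mpr hg
  refine ⟨?_, hopen C h⟩
  rw [← isOpen_compl_iff]
  exact hopen Cᶜ fun u hu g => by simp only [Set.mem_compl_iff, h u hu g]

/-! ### 2. Closed subgroups of a profinite group are intersections of their level-wise stabilizers -/

section Profinite

variable [IsTopologicalGroup P] [CompactSpace P] [TotallyDisconnectedSpace P]

/-- **A closed subgroup `A` of a profinite group is `⋂_U (U ⊔ A)`** over the open normal subgroups `U`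
(for `A = Π_v^γ`: the verticial subgroup is the stabilizer of the compatible system of vertices `U γ Π_v`
of the coverings `G_U` — "recovered as the stabilizers of vertices of finite étale coverings").
[cite: MochizukiCombGC2007, Thm 1.6(ii) p.14] -/
theorem eq_iInf_sup_of_isClosed {A : Subgroup P} (hA : IsClosed (A : Set P)) :
    A = ⨅ U : {U : Subgroup P // U.Normal ∧ IsOpen (U : Set P)}, (U.1 ⊔ A) := by
  refine le_antisymm (le_iInf fun U => le_sup_right) ?_
  intro x hx
  by_contra hxA
  -- an open normal `U₀` with `U₀ · x` disjoint from `A`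
  have hO : IsOpen {u : P | u * x ∈ (A : Set P)ᶜ} :=
    hA.isOpen_compl.preimage (continuous_id.mul continuous_const)
  obtain ⟨U₀, hU₀⟩ := ProfiniteGrp.exist_openNormalSubgroup_sub_open_nhds_of_one hO
    (by simpa using hxA)
  have hxU := (Subgroup.mem_iInf.mp hx) ⟨(U₀ : Subgroup P), inferInstance, U₀.isOpen⟩
  have hxU' : x ∈ (((U₀ : Subgroup P) ⊔ A : Subgroup P) : Set P) := hxU
  rw [Subgroup.normal_mul] at hxU'
  obtain ⟨u, hu, a, ha, rfl⟩ := hxU'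
  have hu' : u⁻¹ ∈ (U₀ : Set P) := inv_mem hu
  have := hU₀ hu'
  simp only [Set.mem_setOf_eq, Set.mem_compl_iff, SetLike.mem_coe, inv_mul_cancel_left] at this
  exact this ha

/-- The conjugates `Π_v^γ` are such intersections. [cite: MochizukiCombGC2007, Thm 1.6(ii) p.14] -/
theorem smul_eq_iInf_sup_of_isClosed {A : Subgroup P} (hA : IsClosed (A : Set P)) (γ : ConjAct P) :
    γ • A = ⨅ U : {U : Subgroup P // U.Normal ∧ IsOpen (U : Set P)}, (U.1 ⊔ γ • A) :=
  eq_iInf_sup_of_isClosed (isClosed_conj_smul hA γ)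

/-- If `x` lies in `B · U` for every open normal `U` and `B` is closed, then `x ∈ B`.
[cite: MochizukiCombGC2007, Thm 1.6(ii) p.14] -/
theorem mem_of_forall_mem_sup {B : Subgroup P} (hB : IsClosed (B : Set P)) {x : P}
    (h : ∀ U : Subgroup P, U.Normal → IsOpen (U : Set P) → x ∈ B ⊔ U) : x ∈ B := by
  rw [eq_iInf_sup_of_isClosed hB]
  refine Subgroup.mem_iInf.mpr fun U => ?_
  rw [sup_comm]
  exact h U.1 U.2.1 U.2.2

/-! ### 3. Conjugacy classes of a finite closed family are recognised LEVEL-WISE -/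

/-- **LEVEL-WISE RECOGNITION of the `Π`-conjugates of a finite family of closed subgroups** (for the
verticial family: "the verticial subgroups may be recovered as the stabilizers of vertices of finite
étale coverings").  For profinite `Π`, a FINITE index type `ι` and closed subgroups `S i`: a subgroup `B`
is `γ • S i` for some `i`, `γ` if and only if `B` is closed and for EVERY open normal `U` the level-`U`
stabilizer `B ⊔ U` equals `U ⊔ γ • S i` for SOME `i`, `γ` — with no compatibility between the pairs
`(i, γ)` chosen at the various levels assumed (a coherent choice is produced by compactness: the admissible
`γ` at the levels form a directed family of nonempty clopen subsets of `Π`).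
[cite: MochizukiCombGC2007, Thm 1.6(ii) p.14] -/
theorem conjClass_iff_levelwise {ι : Type*} [Finite ι] (S : ι → Subgroup P)
    (hS : ∀ i, IsClosed ((S i : Subgroup P) : Set P)) (B : Subgroup P) :
    (∃ (i : ι) (γ : ConjAct P), B = γ • S i) ↔
      IsClosed (B : Set P) ∧
        ∀ U : Subgroup P, U.Normal → IsOpen (U : Set P) →
          ∃ (i : ι) (γ : ConjAct P), B ⊔ U = U ⊔ γ • S i := by
  haveI : T2Space P := inferInstance
  constructor
  · rintro ⟨i, γ, rfl⟩
    exact ⟨isClosed_conj_smul (hS i) γ, fun U _ _ => ⟨i, γ, sup_comm _ _⟩⟩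
  · rintro ⟨hBc, hlev⟩
    -- the directed system of levels (open normal subgroups)
    let 𝒰 := {U : Subgroup P // U.Normal ∧ IsOpen (U : Set P)}
    -- the admissible conjugators at level `U` for the index `i`
    let C : ι → 𝒰 → Set P := fun i U =>
      {g : P | B ⊔ U.1 = U.1 ⊔ ConjAct.toConjAct g • S i}
    have hanti : ∀ (i) (U U' : 𝒰), U'.1 ≤ U.1 → C i U' ⊆ C i U :=
      fun i U U' hle g hg => sup_eq_sup_of_le' hle hg
    have hsat : ∀ (i) (U : 𝒰), ∀ u ∈ U.1, ∀ g : P, u * g ∈ C i U ↔ g ∈ C i U := by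
      intro i U u hu g
      simp only [C, Set.mem_setOf_eq, map_mul, mul_smul, sup_conjAct_smul_eq_of_mem' U.2.1 hu]
    have hclosed : ∀ i U, IsClosed (C i U) := fun i U =>
      (isClopen_of_forall_mul_mem_iff' U.2.2 (hsat i U)).1
    -- some index `i₀` is admissible at every level (the levels are closed under finite `⊓`)
    obtain ⟨i₀, hi₀⟩ : ∃ i, ∀ U : 𝒰, (C i U).Nonempty := by
      by_contra hcon
      simp only [not_exists, not_forall, Set.not_nonempty_iff_eq_empty] at hcon
      choose Uof hUof using hcon
      haveI : Fintype ι := Fintype.ofFinite ι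
      have hn : (⨅ i, (Uof i).1).Normal := Subgroup.normal_iInf_normal fun i => (Uof i).2.1
      have ho : IsOpen ((⨅ i, (Uof i).1 : Subgroup P) : Set P) := by
        rw [Subgroup.coe_iInf]
        exact isOpen_iInter_of_finite fun i => (Uof i).2.2
      obtain ⟨i, γ, hiγ⟩ := hlev _ hn ho
      have hmem : ConjAct.ofConjAct γ ∈ C i ⟨⨅ i, (Uof i).1, hn, ho⟩ := by
        simp only [C, Set.mem_setOf_eq, ConjAct.toConjAct_ofConjAct]
        exact hiγ
      have := hanti i (Uof i) ⟨⨅ i, (Uof i).1, hn, ho⟩ (iInf_le _ i) hmem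
      rw [hUof i] at this
      exact this
    -- uniformisation: one conjugator admissible at every level
    haveI : Nonempty 𝒰 := ⟨⟨⊤, inferInstance, by simp⟩⟩
    have hdir : Directed (· ⊇ ·) (C i₀) := by
      intro U₁ U₂
      have hn : (U₁.1 ⊓ U₂.1).Normal :=
        @Subgroup.normal_inf_normal _ _ U₁.1 U₂.1 U₁.2.1 U₂.2.1
      have ho : IsOpen ((U₁.1 ⊓ U₂.1 : Subgroup P) : Set P) := by
        rw [Subgroup.coe_inf]
        exact U₁.2.2.inter U₂.2.2
      exact ⟨⟨U₁.1 ⊓ U₂.1, hn, ho⟩, hanti i₀ U₁ _ inf_le_left, hanti i₀ U₂ _ inf_le_right⟩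
    obtain ⟨g, hg⟩ :=
      Literature.GroupTheory.CompactGroupIntersections.exists_mem_forall_of_directed
        (C i₀) hdir hi₀ (hclosed i₀)
    -- conclusion: `B = ⋂_U (B ⊔ U) = ⋂_U (U ⊔ (S i₀)^g) = (S i₀)^g`
    have hlev' : ∀ U : 𝒰, B ⊔ U.1 = U.1 ⊔ ConjAct.toConjAct g • S i₀ := fun U => hg U
    refine ⟨i₀, ConjAct.toConjAct g, le_antisymm ?_ ?_⟩
    · rw [smul_eq_iInf_sup_of_isClosed (hS i₀) (ConjAct.toConjAct g)]
      exact le_iInf fun U => le_sup_left.trans (hlev' U).le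
    · rw [smul_eq_iInf_sup_of_isClosed (hS i₀) (ConjAct.toConjAct g)]
      intro x hx
      refine mem_of_forall_mem_sup hBc fun U hUn hUo => ?_
      rw [hlev' ⟨U, hUn, hUo⟩]
      exact Subgroup.mem_iInf.mp hx ⟨U, hUn, hUo⟩

variable (G : PSCDatum P)

/-- **Verticial subgroups are recognised level-wise** ("recovered as the stabilizers of vertices of
finite étale coverings"): `B` is verticial iff `B` is closed and at every level `U` the stabilizer
`B ⊔ U` is the stabilizer `U ⊔ Π_v^γ` of SOME vertex `U γ Π_v` of `G_U`.
[cite: MochizukiCombGC2007, Thm 1.6(ii) p.14] -/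
theorem isVerticial_iff_levelwise (B : Subgroup P) :
    G.IsVerticial B ↔ IsClosed (B : Set P) ∧
      ∀ U : Subgroup P, U.Normal → IsOpen (U : Set P) →
        ∃ (v : G.graph.V) (γ : ConjAct P), B ⊔ U = U ⊔ γ • G.vertGp v :=
  conjClass_iff_levelwise G.vertGp G.isClosed_vertGp B

/-- **Cuspidal subgroups are recognised level-wise** ("the cuspidal edge-like subgroups may be recovered
as the stabilizers of cusps of finite étale coverings", p. 13). [cite: MochizukiCombGC2007, Thm 1.6(i) p.13] -/
theorem isCuspidal_iff_levelwise (B : Subgroup P) :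
    G.IsCuspidal B ↔ IsClosed (B : Set P) ∧
      ∀ U : Subgroup P, U.Normal → IsOpen (U : Set P) →
        ∃ (c : G.graph.C) (γ : ConjAct P), B ⊔ U = U ⊔ γ • G.cuspGp c :=
  conjClass_iff_levelwise G.cuspGp G.isClosed_cuspGp B

/-- **Nodal subgroups are recognised level-wise** (stabilizers of nodes of finite étale coverings).
[cite: MochizukiCombGC2007, Thm 1.6(ii) p.14] -/
theorem isNodal_iff_levelwise (B : Subgroup P) :
    G.IsNodal B ↔ IsClosed (B : Set P) ∧
      ∀ U : Subgroup P, U.Normal → IsOpen (U : Set P) →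
        ∃ (e : G.graph.N) (γ : ConjAct P), B ⊔ U = U ⊔ γ • G.nodeGp e :=
  conjClass_iff_levelwise G.nodeGp G.isClosed_nodeGp B

omit [IsTopologicalGroup P] [CompactSpace P] [TotallyDisconnectedSpace P] in
/-- The edge-like subgroups are the conjugates of the `edgeGp` family (nodes ⊔ cusps).
[cite: MochizukiCombGC2007, Def 1.1(ii) p.6] -/
theorem isEdgeLike_iff_exists_edgeGp (B : Subgroup P) :
    G.IsEdgeLike B ↔ ∃ (e : G.graph.N ⊕ G.graph.C) (γ : ConjAct P), B = γ • G.edgeGp e := by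
  constructor
  · rintro (⟨e, γ, rfl⟩ | ⟨c, γ, rfl⟩)
    · exact ⟨Sum.inl e, γ, rfl⟩
    · exact ⟨Sum.inr c, γ, rfl⟩
  · rintro ⟨e | c, γ, rfl⟩
    · exact Or.inl ⟨e, γ, rfl⟩
    · exact Or.inr ⟨c, γ, rfl⟩

/-- **Edge-like subgroups are recognised level-wise** (stabilizers of edges of finite étale coverings).
[cite: MochizukiCombGC2007, Thm 1.6(ii) p.14] -/
theorem isEdgeLike_iff_levelwise (B : Subgroup P) :
    G.IsEdgeLike B ↔ IsClosed (B : Set P) ∧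
      ∀ U : Subgroup P, U.Normal → IsOpen (U : Set P) →
        ∃ (e : G.graph.N ⊕ G.graph.C) (γ : ConjAct P), B ⊔ U = U ⊔ γ • G.edgeGp e := by
  rw [isEdgeLike_iff_exists_edgeGp]
  exact conjClass_iff_levelwise G.edgeGp G.isClosed_edgeGp B

end Profinite

/-! ### 4. Transport along `α : Π ≅ Π'` is recognised LEVEL-WISE -/

section Transport

variable [IsTopologicalGroup P] [CompactSpace P] [TotallyDisconnectedSpace P]
variable {P' : Type u} [Group P'] [TopologicalSpace P'] [IsTopologicalGroup P'] [CompactSpace P']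
  [TotallyDisconnectedSpace P']
variable (α : P ≃ₜ* P')

omit [IsTopologicalGroup P] [CompactSpace P] [TotallyDisconnectedSpace P] [IsTopologicalGroup P']
  [CompactSpace P'] [TotallyDisconnectedSpace P'] in
/-- The levels of `Π'` are the images of the levels of `Π`. [cite: MochizukiCombGC2007, Def 1.4 p.10] -/
theorem level_map_symm {U' : Subgroup P'} (hU'n : U'.Normal) (hU'o : IsOpen (U' : Set P')) :
    (U'.map α.symm.toMulEquiv.toMonoidHom).Normal ∧
      IsOpen ((U'.map α.symm.toMulEquiv.toMonoidHom : Subgroup P) : Set P) ∧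
      (U'.map α.symm.toMulEquiv.toMonoidHom).map α.toMulEquiv.toMonoidHom = U' := by
  refine ⟨Subgroup.Normal.map hU'n _ α.symm.surjective, ?_, ?_⟩
  · rw [Subgroup.coe_map]
    exact α.symm.isOpenMap _ hU'o
  · rw [Subgroup.map_map]
    convert Subgroup.map_id U'
    ext x
    exact α.apply_symm_apply x

omit [IsTopologicalGroup P] [CompactSpace P] [TotallyDisconnectedSpace P] [IsTopologicalGroup P']
  [CompactSpace P'] [TotallyDisconnectedSpace P'] in
/-- The images of the levels of `Π` are levels of `Π'`. [cite: MochizukiCombGC2007, Def 1.4 p.10] -/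
theorem level_map {U : Subgroup P} (hUn : U.Normal) (hUo : IsOpen (U : Set P)) :
    (U.map α.toMulEquiv.toMonoidHom).Normal ∧
      IsOpen ((U.map α.toMulEquiv.toMonoidHom : Subgroup P') : Set P') := by
  refine ⟨Subgroup.Normal.map hUn _ α.surjective, ?_⟩
  rw [Subgroup.coe_map]
  exact α.isOpenMap _ hUo

omit [TopologicalSpace P] [IsTopologicalGroup P] [CompactSpace P] [TotallyDisconnectedSpace P]
  [TopologicalSpace P'] [IsTopologicalGroup P'] [CompactSpace P'] [TotallyDisconnectedSpace P'] in
/-- `α⁻¹(α(B)) = B` (local copy of `PSCCuspidalCriterionProofs.map_symm_map`). [cite: MochizukiCombGC2007, Def 1.4 p.10] -/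
private theorem map_symm_map' (α : P ≃* P') (B : Subgroup P) :
    (B.map α.toMonoidHom).map α.symm.toMonoidHom = B := by
  rw [Subgroup.map_map]
  convert Subgroup.map_id B
  ext x
  exact α.symm_apply_apply x

/-- **TRANSPORT of conjugacy-class conditions along `α` is recognised LEVEL-WISE.**  For profinite `Π`,
`Π'`, a topological isomorphism `α : Π ≅ Π'` and finite closed families `S : ι → Subgroup Π`,
`T : ι' → Subgroup Π'`: "`α` carries every `Π`-conjugate of an `S i` to a `Π'`-conjugate of some `T j`, and
every `Π'`-conjugate of a `T j` so arises" holds if and only if at every level `U` of `Π` and for every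
`V ≥ U`, `V` is an `S`-stabilizer `U ⊔ γ • S i` iff `α(V)` is a `T`-stabilizer `α(U) ⊔ δ • T j` — i.e. iff
`α` induces, functorially in the level, `Π/U`-equivariant bijections between the (finite) sets of
`S`-objects of `G_U` and of `T`-objects of `H_{αU}`, read on their stabilizers ("`α` induces a functorial
bijection between the sets of vertices [cusps] of `G`, `H`"). [cite: MochizukiCombGC2007, Thm 1.6(ii) p.14] -/
theorem transport_iff_levelwise {ι ι' : Type*} [Finite ι] [Finite ι'] (S : ι → Subgroup P)
    (hS : ∀ i, IsClosed ((S i : Subgroup P) : Set P)) (T : ι' → Subgroup P')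
    (hT : ∀ j, IsClosed ((T j : Subgroup P') : Set P')) :
    ((∀ A : Subgroup P, (∃ (i : ι) (γ : ConjAct P), A = γ • S i) →
        ∃ (j : ι') (δ : ConjAct P'), A.map α.toMulEquiv.toMonoidHom = δ • T j) ∧
      ∀ B : Subgroup P', (∃ (j : ι') (δ : ConjAct P'), B = δ • T j) →
        ∃ A : Subgroup P, (∃ (i : ι) (γ : ConjAct P), A = γ • S i) ∧
          A.map α.toMulEquiv.toMonoidHom = B) ↔
    ∀ U : Subgroup P, U.Normal → IsOpen (U : Set P) → ∀ V : Subgroup P, U ≤ V →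
      ((∃ (i : ι) (γ : ConjAct P), V = U ⊔ γ • S i) ↔
        ∃ (j : ι') (δ : ConjAct P'),
          V.map α.toMulEquiv.toMonoidHom = U.map α.toMulEquiv.toMonoidHom ⊔ δ • T j) := by
  constructor
  · rintro ⟨h₁, h₂⟩ U hUn hUo V hUV
    constructor
    · rintro ⟨i, γ, rfl⟩
      obtain ⟨j, δ, hδ⟩ := h₁ _ ⟨i, γ, rfl⟩
      exact ⟨j, δ, by rw [Subgroup.map_sup, hδ]⟩
    · rintro ⟨j, δ, hδ⟩
      obtain ⟨A, ⟨i, γ, rfl⟩, hA⟩ := h₂ _ ⟨j, δ, rfl⟩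
      refine ⟨i, γ, ?_⟩
      apply Subgroup.map_injective (f := α.toMulEquiv.toMonoidHom) α.injective
      rw [hδ, Subgroup.map_sup, hA]
  · intro h
    constructor
    · rintro A ⟨i, γ, rfl⟩
      -- `α(γ • S i)` is closed and level-wise a `T`-stabilizer
      refine (conjClass_iff_levelwise T hT _).mpr ⟨?_, fun U' hU'n hU'o => ?_⟩
      · rw [Subgroup.coe_map]
        exact (α.isClosedMap _ (isClosed_conj_smul (hS i) γ))
      obtain ⟨hUn, hUo, hUU'⟩ := level_map_symm α hU'n hU'o
      obtain ⟨j, δ, hjδ⟩ := (h _ hUn hUo (_ ⊔ γ • S i) le_sup_left).mp ⟨i, γ, rfl⟩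
      refine ⟨j, δ, ?_⟩
      rw [Subgroup.map_sup, hUU'] at hjδ
      rw [sup_comm, hjδ]
    · rintro B ⟨j, δ, rfl⟩
      refine ⟨(δ • T j).map α.symm.toMulEquiv.toMonoidHom, ?_, ?_⟩
      · refine (conjClass_iff_levelwise S hS _).mpr ⟨?_, fun U hUn hUo => ?_⟩
        · rw [Subgroup.coe_map]
          exact (α.symm.isClosedMap _ (isClosed_conj_smul (hT j) δ))
        obtain ⟨hU'n, hU'o⟩ := level_map α hUn hUo
        have hstab : ∃ (j' : ι') (δ' : ConjAct P'),
            (U ⊔ (δ • T j).map α.symm.toMulEquiv.toMonoidHom).map α.toMulEquiv.toMonoidHom =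
              U.map α.toMulEquiv.toMonoidHom ⊔ δ' • T j' := by
          refine ⟨j, δ, ?_⟩
          rw [Subgroup.map_sup]
          congr 1
          exact map_symm_map' α.symm.toMulEquiv (δ • T j)
        obtain ⟨i, γ, hiγ⟩ := (h U hUn hUo _ le_sup_left).mpr hstab
        exact ⟨i, γ, by rw [sup_comm, hiγ]⟩
      · exact map_symm_map' α.symm.toMulEquiv (δ • T j)

variable (G : PSCDatum P) (H : PSCDatum P')

/-- **`α` is group-theoretically VERTICIAL iff it induces, functorially in the level, equivariant
bijections between the vertex sets of corresponding finite étale coverings, read on stabilizers**: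
at every level `U` and for every `V ≥ U`, `V = U ⊔ Π_v^γ` for some vertex iff `α(V) = α(U) ⊔ Π_w^δ` for
some vertex — "to prove that `α` is group-theoretically verticial, it suffices to prove that `α` induces
a functorial bijection between the sets of vertices of `G`, `H`" (p. 14 l.25–28).
[cite: MochizukiCombGC2007, Thm 1.6(ii) p.14] -/
theorem isGroupTheoreticallyVerticial_iff_levelwise :
    G.IsGroupTheoreticallyVerticial H α ↔
      ∀ U : Subgroup P, U.Normal → IsOpen (U : Set P) → ∀ V : Subgroup P, U ≤ V →
        ((∃ (v : G.graph.V) (γ : ConjAct P), V = U ⊔ γ • G.vertGp v) ↔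
          ∃ (w : H.graph.V) (δ : ConjAct P'),
            V.map α.toMulEquiv.toMonoidHom = U.map α.toMulEquiv.toMonoidHom ⊔ δ • H.vertGp w) := by
  have h := transport_iff_levelwise α G.vertGp G.isClosed_vertGp H.vertGp H.isClosed_vertGp
  exact ⟨fun hv => h.mp ⟨fun A ⟨v, γ, hA⟩ => by
      obtain ⟨w, δ, h'⟩ := hv.1 A ⟨v, γ, hA⟩; exact ⟨w, δ, h'⟩,
    fun B ⟨w, δ, hB⟩ => by
      obtain ⟨A, ⟨v, γ, hA⟩, hAB⟩ := hv.2 B ⟨w, δ, hB⟩; exact ⟨A, ⟨v, γ, hA⟩, hAB⟩⟩,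
    fun hl => by
      obtain ⟨h₁, h₂⟩ := h.mpr hl
      exact ⟨fun A ⟨v, γ, hA⟩ => by obtain ⟨w, δ, h'⟩ := h₁ A ⟨v, γ, hA⟩; exact ⟨w, δ, h'⟩,
        fun B ⟨w, δ, hB⟩ => by
          obtain ⟨A, ⟨v, γ, hA⟩, hAB⟩ := h₂ B ⟨w, δ, hB⟩; exact ⟨A, ⟨v, γ, hA⟩, hAB⟩⟩⟩

/-- **`α` is group-theoretically CUSPIDAL iff it induces, functorially in the level, equivariant
bijections between the cusp sets of corresponding finite étale coverings, read on stabilizers** — "Since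
the cuspidal edge-like subgroups may be recovered as the stabilizers of cusps of finite étale coverings
of `G`, `H`, it suffices to show that `α` induces a functorial bijection between the sets of cusps"
(p. 13 l.−9 – −7). [cite: MochizukiCombGC2007, Thm 1.6(i) p.13] -/
theorem isGroupTheoreticallyCuspidal_iff_levelwise :
    G.IsGroupTheoreticallyCuspidal H α ↔
      ∀ U : Subgroup P, U.Normal → IsOpen (U : Set P) → ∀ V : Subgroup P, U ≤ V →
        ((∃ (c : G.graph.C) (γ : ConjAct P), V = U ⊔ γ • G.cuspGp c) ↔
          ∃ (c' : H.graph.C) (δ : ConjAct P'),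
            V.map α.toMulEquiv.toMonoidHom = U.map α.toMulEquiv.toMonoidHom ⊔ δ • H.cuspGp c') := by
  have h := transport_iff_levelwise α G.cuspGp G.isClosed_cuspGp H.cuspGp H.isClosed_cuspGp
  exact ⟨fun hv => h.mp ⟨fun A ⟨c, γ, hA⟩ => by
      obtain ⟨c', δ, h'⟩ := hv.1 A ⟨c, γ, hA⟩; exact ⟨c', δ, h'⟩,
    fun B ⟨c', δ, hB⟩ => by
      obtain ⟨A, ⟨c, γ, hA⟩, hAB⟩ := hv.2 B ⟨c', δ, hB⟩; exact ⟨A, ⟨c, γ, hA⟩, hAB⟩⟩,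
    fun hl => by
      obtain ⟨h₁, h₂⟩ := h.mpr hl
      exact ⟨fun A ⟨c, γ, hA⟩ => by obtain ⟨c', δ, h'⟩ := h₁ A ⟨c, γ, hA⟩; exact ⟨c', δ, h'⟩,
        fun B ⟨c', δ, hB⟩ => by
          obtain ⟨A, ⟨c, γ, hA⟩, hAB⟩ := h₂ B ⟨c', δ, hB⟩; exact ⟨A, ⟨c, γ, hA⟩, hAB⟩⟩⟩

/-- **`α` is group-theoretically EDGE-LIKE iff it induces, functorially in the level, equivariant
bijections between the edge sets of corresponding finite étale coverings, read on stabilizers.**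
[cite: MochizukiCombGC2007, Thm 1.6(ii) p.14] -/
theorem isGroupTheoreticallyEdgeLike_iff_levelwise :
    G.IsGroupTheoreticallyEdgeLike H α ↔
      ∀ U : Subgroup P, U.Normal → IsOpen (U : Set P) → ∀ V : Subgroup P, U ≤ V →
        ((∃ (e : G.graph.N ⊕ G.graph.C) (γ : ConjAct P), V = U ⊔ γ • G.edgeGp e) ↔
          ∃ (e' : H.graph.N ⊕ H.graph.C) (δ : ConjAct P'),
            V.map α.toMulEquiv.toMonoidHom = U.map α.toMulEquiv.toMonoidHom ⊔ δ • H.edgeGp e') := by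
  have h := transport_iff_levelwise α G.edgeGp G.isClosed_edgeGp H.edgeGp H.isClosed_edgeGp
  rw [← h]
  simp only [← isEdgeLike_iff_exists_edgeGp]
  exact Iff.rfl

end Transport

end PSCDatum

end Literature.AnabelianGeometry.SemiGraphs
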